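import Mathlib
import HarnessLib
import HarnessLib.Audit
import Summits.ValiantsHypothesis.Statement

/-!
Route: TauConst

DORMANT since 2026-09-04T06:52:50Z (reconciler: no traction for 5 d (last activity item-evidence-added at 2026-08-30T06:05:33Z); parked, not closed — `ledger route dormant route-ValiantsHypothesis-TauConst --off` to reactivate) — unstaffed, not closed; items shared with open routes are served there. `ledger route dormant <id> --off` reactivates.

# Route TauConst — the τ-conjecture plus constant elimination for the permanent

**Thesis X.** It suffices to show X = X1 ∧ X2, where
(X1, crux `TauConjecture`) is the Shub–Smale τ-conjecture [ShubSmale1995 §1; BlumCuckerShubSmale1998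
Ch. 7 §7.1]: a nonzero
f ∈ ℤ[T] has at most (τ(f)+2)^c distinct integer roots, τ = the constant-free {+,−,×}-complexity of
f from 1 and T
(`Literature.Computability.AlgebraicComplexity.constantFreeComplexity` of f transported to
`MvPolynomial (Fin 1) ℤ`; equal to
Shub–Smale's τ up to a factor ≤ 3, absorbed by c; `+ 2` avoids the 0^c/1^c degeneracies), and
(X2, crux `TauConstElim`) is constant elimination for the permanent: if VP_ℂ = VNP_ℂ then n ↦
τ(PER_n) (constant-free complexity of
the generic n × n permanent over ℤ) is p-bounded. X is filed verbatim as the target item `TauThesis`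
(= `TauConjecture ∧ TauConstElim`
definitionally).
Lean: `(∃ c : ℕ, ∀ f : Polynomial ℤ, f ≠ 0 → f.roots.toFinset.card ≤
(Literature.Computability.AlgebraicComplexity.constantFreeComplexity ((MvPolynomial.uniqueAlgEquiv ℤ
(Fin 1)).symm f) + 2) ^ c) ∧ (Literature.Computability.AlgebraicComplexity.VP ℂ =
Literature.Computability.AlgebraicComplexity.VNP ℂ →
Literature.Computability.AlgebraicComplexity.IsPBounded (fun n =>
Literature.Computability.AlgebraicComplexity.constantFreeComplexity
(Literature.Computability.AlgebraicComplexity.perPoly (Fin n) ℤ)))`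

## Assembly
Deciding theorem (D-0027 §2.1): `closes (h_TauConjecture : TauConjecture) (h_TauConstElim :
TauConstElim) (h_TauBurgisser : TauBurgisser) :
ValiantsHypothesis := fun hEq => h_TauBurgisser h_TauConjecture (h_TauConstElim hEq)` — pure logic:
`ValiantsHypothesis` unfolds to
VP ℂ ≠ VNP ℂ; under VP ℂ = VNP ℂ, X2 makes τ(PER_n) p-bounded while Bürgisser's transfer theorem
(support `TauBurgisser`
[Burgisser2009 Main Thm 1.2]) applied to X1 makes it not p-bounded. `TauBurgisser` is a support
hypothesis, not an import, on purpose: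
the transfer theorem is DISCHARGED in the tree
(`Literature.Computability.AlgebraicComplexity.not_isPBounded_constantFreeComplexity_perPoly_of_tauConjecture_holds`,
module `Literature.Computability.AlgebraicComplexity.TauConjectureDischarge`), so a Theorems file
importing that module closes the
item in one line, while the route file's import cone stays that of the Statement.
Second assembly, recorded but not the deciding theorem of this route (one `closes` per route):
`TauReal → TauRealValiant →
ValiantsHypothesis` through
`Literature.Computability.AlgebraicComplexity.perNotPComputableComplex_iff_holds` [Tavenas2014 Thm
3.38;
Burgisser2024Completeness §4.6 p. 20] — the real τ-conjecture needs NO constant elimination;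
recommended as the sibling route `RealTau`
sharing both items (see rationale, NOT DECOMPOSED YET).

Rationale: WHY THIS LINE. The line imports the Diophantine geometry of polynomials with short straight-line
programs: X1 is a statement about
INTEGER zeros of SLP-short f ∈ ℤ[T] (heights, p-adic interpolation à la Strassmann, reduction mod p,
Bombieri–Pila counting are the
expected tools), and its real-geometry cousin — Koiran's real τ-conjecture for sums of products of
sparse polynomials [Koiran2011 §6
Conj. 3 = arXiv:1004.4960; Burgisser2024Completeness = arXiv:2406.06217 Conj. 4.1; true on average,
BriquelBurgisser2020 =
arXiv:1806.00417] — is crux TauReal. On the algebraic-complexity side nothing is conjectural any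
more except the constant gap: BOTH
transfer theorems "τ-conjecture ⇒ τ(PER_n) = n^{ω(1)}" are theorems of the tree (Bürgisser 2009 Main
Thm 1.2 =
`Literature.Computability.AlgebraicComplexity.not_isPBounded_constantFreeComplexity_perPoly_of_shubSmaleTauConjecture`,
TauConjectureDischarge.lean; Tavenas 2014 Thm 3.3 = `…_of_koiranRealTauConjecture`,
RealTauConjectureDischarge.lean). The honest
distance from constant-free lower bounds (VP⁰) to VP_ℂ ≠ VNP_ℂ is X2, printed as open in 2026
(arXiv:2606.25121 §1.2: "VP_ℂ ≠ VNP_ℂ ⇒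
VP⁰ ≠ VNP⁰ is trivial, but the converse is unclear"; arXiv:2601.00387 §2.1), with partial
eliminations only for BSS decision
problems (BlumCuckerShubSmale1998 Ch. 7 Prop. 9) or for Boolean consequences under GRH
(Burgisser2000 Thm 4.5; Koiran1996); making
X2 an explicit rank-2 crux — it is also the hidden hypothesis of PIT-based lines
(Kabanets–Impagliazzo) and the algebraic face of
BoolTransfer.BoolGrhFree — is the point of the route. No other route of the summit and nothing in
the negatives index (3 refuted
statements, all on Elusive / GrenetRigidity) touches zero counting.

RANKED CRUXES. #2 TauConstElim — VP ℂ = VNP ℂ → IsPBounded (n ↦ τ(PER_n over ℤ)) (why it might fail: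
PER may lie in VP_ℂ only
through constants — 1/2, 2^{p(n)}-bit integers, algebraic or transcendental numbers — while τ(PER_n)
= n^{ω(1)}; constant-free
completeness of PER holds only up to factors 2^{p(n)} [Koiran2004 Thm 4.3 = tree
`Burgisser2009_thm210`]; sources arXiv:2606.25121
§1.2, arXiv:2601.00387 §2.1 p. 7, arXiv:1307.3863 p. 17, Burgisser2000 Ch. 4). As a material
implication from VP ℂ = VNP ℂ it is
refutable only together with the summit; its uniform, independently refutable form is left for the
layer-2 split (NOT DECOMPOSED
YET). #3 TauConjecture — Shub–Smale [ShubSmale1995 §1; BlumCuckerShubSmale1998 Ch. 7 §7.1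
"Hypothesis"] (why it might fail: false if
∏_{i≤n}(T−i) or some m_n·n! has τ = (log n)^{O(1)} — open, best known τ(n!) = O(√n log² n)
[arXiv:1307.3863 p. 17]; the REAL-zero
analogue is false — barrier `Literature.Barriers.ValiantsHypothesis.TauRealZeros`, Chebyshev T_{2^k}
— so integrality must enter;
only z(f) ≤ 2^{τ(f)} is known for general SLPs). #4 TauReal — Koiran's real τ-conjecture, distinct
real zeros of Σ_{i<k} Π_{j<m} f_ij
with t-sparse f_ij ≤ (k+m+t+2)^c [Koiran2011 §6 Conj. 3; Tavenas2014 Conj. 3.2] (why it might fail: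
known are only the expansion
bound 2kt^m − 1, the case k = 1 (≤ 2m(t−1)+1, tree `koiranRealTauConjecture_of_k_le_one`), Wronskian
partial bounds
(Koiran–Portier–Tavenas 2015) and the Gaussian average (arXiv:1806.00417); Koiran notes k = 2 is
already open; one explicit SPS family
with (kmt)^{ω(1)} real zeros kills it). TauReal is NOT a hypothesis of `closes`: it is the
alternative entry — it replaces TauConjecture
in the same contradiction through the discharged Koiran–Tavenas transfer, and with the support item
TauRealValiant it needs no
TauConstElim at all (second assembly; TWO-LAYER PLAN, SUPPORT).

KILL CRITERIA. TauConjecture refuted — a sequence f_k ∈ ℤ[T], f_k ≠ 0, τ(f_k) ≤ k, with more than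
k^c distinct integer roots for
every c eventually (candidates ∏_{i≤n}(T−i), multiples m_n·n!; (T^{2^k} − 1)-type examples have ≤ 2
integer roots, Chebyshev
examples have real but not integer zeros) — kills X1: pivot to the second assembly (TauReal,
TauRealValiant), i.e. re-thesis as /
supersede by the sibling `RealTau`, or `close --reason refuted:TauConjecture` if TauReal is dead
too. TauReal refuted (an explicit
Σ^kΠ^m family of t-sparse real polynomials with superpolynomially many distinct real zeros) kills
only the alternative entry; the
deciding theorem is untouched. ¬TauConstElim is (VP ℂ = VNP ℂ) ∧ ¬IsPBounded τ(PER): it cannot close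
before the summit itself is
refuted — a refuter's "vacuous as stated" finding is answered by filing the uniform form (NOT
DECOMPOSED YET (b)), not by closing the
route. Mooted if: an unconditional τ(PER_n) = n^{ω(1)} lands (then only X2 remains, shared in
substance with BoolTransfer), or VH by
any other route.

NOT DECOMPOSED YET. (a) The Diophantine attack on X1 for specific SLP shapes — adelic/height bounds,
m-adic Strassmann counting of
integer zeros, Koiran–Portier–Tavenas–Thomassé's τ-conjecture for Newton polygons (arXiv:1308.2286;
Tavenas2014 Conj. 3.31, Thm 3.39)
— layer-2 children of TauConjecture once a grounder fixes an SLP normal form. (b) The uniform,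
independently refutable form of X2,
`IsPBounded (n ↦ L_ℂ(PER_n)) → IsPBounded (n ↦ τ(PER_n))` (eliminate arbitrary complex constants
from polynomial-size circuits for
PER_n at polynomial cost; implies TauConstElim through
`Literature.Computability.AlgebraicComplexity.perNotPComputableComplex_iff_holds`),
with its natural glued split transcendental → algebraic constants (Burgisser2000 §4.1, model
completeness of ACF₀) and algebraic →
constant-free (the 2^{p(n)} completeness defect, Koiran2004 Thm 4.3; a GRH-free Burgisser2000 Thm
4.5) — filed by tenure as
`--split TauConstElim` (k = 2 + glue). (c) The sibling deciding theorem `TauReal → TauRealValiant →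
ValiantsHypothesis`
(`closes := fun hR hV => (perNotPComputableComplex_iff_holds).mp (hV hR)`, needs the route import
`Literature.Computability.AlgebraicComplexity.ValiantConjectureEquivProofs`) is not opened from this
repair seat (no new routes):
recommended to the next survey/tenure planner as route `RealTau`, items TauReal
(stmt-ValiantsHypothesis-0358) and TauRealValiant
shared by signature, TauReal ranked 2 there.

CHEAPEST FALSIFIER. X1: an SLP search for τ-upper bounds of ∏_{i≤n}(T−i) and of small multiples m·n!
for n ≤ 2^12 — growth like
(log n)^{O(1)} rather than the known O(√n log² n) would retire TauConjecture in practice (lookup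
first: arXiv:1307.3863 p. 17 and
Burgisser2024Completeness §4.6 record (n!) as "famously open", no such SLPs known). TauReal: no
finite computation refutes an ∃c
bound; the cheapest kill is a printed SPS family with many real zeros — none as of
Burgisser2024Completeness §4.6 (2024) and
arXiv:2601.00387 §1 (2026). X2: lookup only — arXiv:2606.25121 §1.2 (2026) prints the converse VP⁰ ≠
VNP⁰ ⇒ VP_ℂ ≠ VNP_ℂ as
"unclear". Nothing run here (compute-free hub, repair seat).

TWO-LAYER PLAN. TauConstElim ⇐ ConstElimTranscendental → ConstElimAlgebraic → TauConstElim (k = 2,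
(b) above; glue = composition +
`perNotPComputableComplex_iff_holds`). TauConjecture: no split before an SLP normal-form lemma
lands. Second assembly inside the route:
TauReal → TauRealValiant → ValiantsHypothesis (both items filed; the implication is one line over
`perNotPComputableComplex_iff_holds`).

SOURCES. ShubSmale1995; BlumCuckerShubSmale1998 Ch. 7; Burgisser2000 Ch. 4; Burgisser2009 Main Thm
1.2; Koiran2004 Thm 4.3;
Koiran2011 = arXiv:1004.4960 §6; Tavenas2014 =
paper:doi-10-70675-52eccebdz020az4a8dz8517z14d4aa632482 (Thm 3.3, Lemme 3.26,
Cor. 3.37, Thm 3.38, Thm 3.39); Burgisser2024Completeness = arXiv:2406.06217 §4.6 (Thm 4.17, Conj.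
4.1, p. 20); arXiv:2606.25121
§1.2, §2.1; arXiv:2601.00387 §1, §2.1; arXiv:1307.3863 p. 17; arXiv:1806.00417; arXiv:1308.2286;
Koiran1996; Valiant1979.

SUPPORT. TauBurgisser (stmt-ValiantsHypothesis-0337) — PROVABLE NOW, one line: in a Theorems file
importing
`Literature.Computability.AlgebraicComplexity.TauConjectureDischarge`,
`theorem tauBurgisser : TauConst.TauBurgisser :=
Literature.Computability.AlgebraicComplexity.not_isPBounded_constantFreeComplexity_perPoly_of_tauConjecture_holds`
(the item body is the fact `…_of_tauConjecture` verbatim). TauRealValiant (new, rank 9) —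
Tavenas2014 Thm 3.38 over ℂ: TauReal →
¬ IsPBounded (n ↦ L_ℂ(PER_n)) (definitionally TauReal →
`Literature.Computability.AlgebraicComplexity.PerNotPComputableComplex`,
checked `Iff.rfl`); printed as "τ-conjecture réelle avec puissances ⇒ Perm ∉ VP" (thesis PDF p. 59)
with Lemme 3.26 (p. 53: Conj.
3.23 ⇔ 3.24) and Conj. 3.2 ⇒ Conj. 3.23 (p. 52), VP = VP_ℚ by the thesis' convention (p. 22) and a
proof valid verbatim over ℝ (the
P-definable Hutchinson family V_n = Σ_{i<2^n} 2^{2·2^n·i − 2i(i+1)} X^i, Cor. 3.37 — tree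
`Tavenas2014_cor_3_37`, discharged in
TavenasVnWitness.lean — then depth-4 reduction WITH constants and the real-zero bound); ℂ-constants
reduce to ℝ-constants by
splitting every gate into real and imaginary parts (size × ≤ 6; PER_n has integer coefficients);
restated for VP over ℂ in
Burgisser2024Completeness §4.6 p. 20 ("even VP ≠ VNP follows; see [tavenas-thesis]"). Tree gap for a
prover: the with-constants
analogue of `exists_sps_of_isProjection_perPoly` (RealTauConjectureViaVn.lean, `complexity` over ℝ
or ℂ in place of
`constantFreeComplexity`) plus the ℂ → ℝ splitting — difficulty M. TauThesis (0333, target) =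
TauConjecture ∧ TauConstElim
(Iff.rfl). Assembly (0334) = TauThesis → TauBurgisser → ValiantsHypothesis, one line of logic;
superseded by `closes`, kept as a
harmless provable-now item.

Novelty: NOVELTY (retriage audit). Nearest prior art: the bridge (i) ⇒ τ(per_n) = n^{ω(1)} IS Bürgisser 2009
Main Thm 1.2 (tree fact `not_isPBounded_constantFreeComplexity_perPoly_of_tauConjecture`; "The
τ-conjecture implies VP⁰ ≠ VNP⁰", Burgisser2024Completeness Thm 4.17, arXiv:2406.06217 p.19). The
gap (ii) = crux TauConstElim is printed as OPEN in 2026 by Bürgisser (arXiv:2606.25121 §1.2 p.3: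
"VP_C ≠ VNP_C ⇒ VP⁰ ≠ VNP⁰ is trivial, but the converse is unclear"; Thm 1.1 there: P⁰_C ≠ NP⁰_C ⇒
VP⁰ ≠ VNP⁰) and by Bhattacharjee–Bläser–Dutta–Mukherjee (arXiv:2601.00387 §2.1 p.7: "not clear
whether VP⁰ ≠ VNP⁰ implies VP ≠ VNP … divisions by two occur"). Partial eliminations only:
Burgisser2000 Ch.4 (same-characteristic invariance; Boolean consequences under GRH, Thm 4.5/Cor
4.6), BlumCuckerShubSmale1998 Ch.7 Prop 9 / witness sequences (decision problems: P_C = NP_C ⇔ P⁰_C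
= NP⁰_C), Koiran2004 Thm 4.3 (completeness up to 2^{p(n)}).
Delta: none in mechanism — the classical Shub–Smale/Bürgisser τ-line with the constant gap promoted
to an explicit rank-2 crux; expected grade known (bridge) / variant (crux isolation).
Audit finding: the route UNDER-USES its item TauReal. Koiran's real τ-conjecture already gives Perm
∉ VP WITH arbitrary constants and without GRH — Tavenas2014 Thm 3.38 (PDF p.59) via Lemme 3.26
(p.53) and Conj 3.2 ⇒ Conj 3.23, because the many-real-zeros polynomial V_n = Σ 2^{2·2^n·i −
2i(i+1)} X^i is definable in P, bypassing the CH-collapse step that needs per ∈ VP⁰ (Rem 3.22,  [refs: 10.1007/978-3-030-79416-3_5, 10.1007/s00037-024-00249-0, 2406.06217, 2606.25121, 2601.00387, 1308.2286, 1004.4960, 1307.3863, doi:10.1007/978-3-030-79416-3_5, doi:10.1007/s00037-024-00249-0, arxiv:1004.4960, paper:doi-10-70675-52eccebdz020az4a8dz8517z14d4aa632482, Burgisser2000, BlumCuckerShubSmale1998, Koiran2004, Tavenas2014]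

Barriers (technique_class: tau-conjecture, integer-zero-counting, constant-elimination): `Literature.Barriers.ValiantsHypothesis.TauRealZeros` (proved: `tauRealZeros_holds`; Chebyshev
T_{2^k} has τ ≤ 3k and 2^k distinct real zeros [Koiran2011 §1 p.3; Burgisser2024Completeness §4.6])
— APPLIES to crux TauConjecture: every `RealZeroTauBound c` is refuted, so a proof of (i) must use
the integrality of the zeros (heights, p-adic/Strassmann, reduction mod p), not real-zero counting
of general SLPs; no such Diophantine technique controlling ℤ-points of general straight-line
programs exists — that is the bet of crux #3. Crux TauReal evades it exactly as catalogued
(evasions_known: restrict the CIRCUITS to sums of products of sparse polynomials instead of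
restricting the zeros), and by Tavenas2014 Thm 3.38 that evasion even reaches VP ≠ VNP with
constants.
Uncatalogued but load-bearing — the constant barrier (crux TauConstElim, rank 2): completeness of
per in the constant-free model holds only up to factors 2^{p(n)} (tree
`Literature.Computability.AlgebraicComplexity.Burgisser2009_thm210` = Koiran2004 Thm 4.3), and
elimination of complex constants is known only for BSS decision problems (BlumCuckerShubSmale1998
Ch.7 Prop 9; witness sequences, arXiv:2606.25121 §2.1) or for Boolean consequences under GRH
(Burgisser2000 Thm 4.5; sibling crux BoolTransfer.BoolGrhFree). The route does not evade it; it bets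
on it ("converse is unclear", arXiv:2606.25121 §1.2).
`Literature.Barriers.ValiantsHypothesis.AlgebraicNaturalProofs` (conditional on
`SuccinctHittingSetsForVP`) — does not

History (route lifecycle, newest last):
- 2026-08-16T02:17:19Z · AUTO-CRUX: 2 conjecture-grade item(s) promoted to crux (TauThesis, TauBurgisser) — refuter vetting / tiering apply (operator:999:1362873)
- 2026-08-23T13:42:13Z · DORMANT — reconciler: no traction for 6.1 d (last activity item-evidence-added at 2026-08-17T11:10:57Z); parked, not closed — `ledger route dormant route-ValiantsHypothes (operator:999:2484533)
- 2026-08-26T05:45:36Z · REACTIVATED — reconciler: reactivated — activity item-proof-filed at 2026-08-26T05:08:05Z after parking at 2026-08-23T13:42:13Z (operator:999:969033)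
- 2026-09-04T06:52:50Z · DORMANT — reconciler: no traction for 5 d (last activity item-evidence-added at 2026-08-30T06:05:33Z); parked, not closed — `ledger route dormant route-ValiantsHypothesis (operator:999:1875645)

sub-problem: ValiantsHypothesis · status: dormant · opened planner-ValiantsHypothesis-Survey-0 2026-08-13T06:08:40Z · rev 3 · ledger route-ValiantsHypothesis-TauConst
GENERATED by the gate from the ledger (D-0016/17). Provers cite these decls: `theorem foo : Summit.ValiantsHypothesis.ValiantsHypothesis.Theses.TauConst.<Decl> := …` in Summits/ValiantsHypothesis/ValiantsHypothesis/Theorems/<Name>.lean.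
-/

namespace Summit.ValiantsHypothesis.ValiantsHypothesis.Theses.TauConst

open scoped BigOperators Topology Manifold Classical MeasureTheory ProbabilityTheory Matrix InnerProductSpace ComplexConjugate ContinuousMap
open Filter Set Function TopologicalSpace MeasureTheory

attribute [summit_statement] _root_.ValiantsHypothesis

open Literature.PNP

/-- item stmt-ValiantsHypothesis-0333 · target · rank 0 · open · by planner
why it might fail: X conjoins two independent open statements: (i) dies if ∏_{i≤n}(X−i) or some m_n·n! has τ=(log n)^O(1) (open); (ii) is the constant gap, 'VP_C≠VNP_C ⇒ VP⁰≠VNP⁰ trivial, converse unclear' (Bürgisser 2026). And (ii) is not even needed if (i) is swapped for TauReal (Tavenas2014 Thm 3.38).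
sources: ShubSmale1995 §1 (as reprinted BlumCuckerShubSmale1998 Ch.7 §7.1 'Hypothesis', panama:519115517198346), Burgisser2024Completeness = arXiv:2406.06217 §4.6 pp.19-20 (Thm 4.17: τ-conjecture ⇒ VP⁰ ≠ VNP⁰; factorials hard ⇒ same; 'even VP ≠ VNP follows [from the real τ-conjecture]; see [tavenas-thesis]'), arXiv:2606.25121 (Bürgisser 2026) §1.2 p.3: 'The implication VP_C ≠ VNP_C ⇒ VP⁰ ≠ VNP⁰ is trivial, but the converse is unclear', Tavenas2014 (paper:doi-10-70675-52eccebdz020az4a8dz8517z14d4aa632482) PDF p.59 Thm 3.38 with p.53 Lemme 3.26, tree: Literature.Computability.AlgebraicComplexity.ShubSmaleTauConjecture (TauConjecture.lean:74) = conjunct (i) verbatim; conjunct (ii) = item 0335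
Thesis of route TauConst: (i) Shub–Smale τ-conjecture [ShubSmale1995]: distinct integer roots of
nonzero f ∈ ℤ[T] ≤ (τ(f)+2)^c with τ =
Literature.Computability.AlgebraicComplexity.constantFreeComplexity of f viewed in MvPolynomial (Fin
1) ℤ; (ii) VP ℂ = VNP ℂ ⇒ τ(per_n over ℤ) p-bounded. (i) ⇒ per ∉ VP⁰ [Burgisser2009]; (ii) closes
the gap VP⁰ vs VP_ℂ. -/
@[route_item "route-ValiantsHypothesis-TauConst"]
def TauThesis : Prop :=
  (∃ c : ℕ, ∀ f : Polynomial ℤ, f ≠ 0 → f.roots.toFinset.card ≤ (Literature.Computability.AlgebraicComplexity.constantFreeComplexity ((MvPolynomial.uniqueAlgEquiv ℤ (Fin 1)).symm f) + 2) ^ c) ∧ (Literature.Computability.AlgebraicComplexity.VP ℂ = Literature.Computability.AlgebraicComplexity.VNP ℂ → Literature.Computability.AlgebraicComplexity.IsPBounded (fun n => Literature.Computability.AlgebraicComplexity.constantFreeComplexity (Literature.Computability.AlgebraicComplexity.perPoly (Fin n) ℤ)))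

/-- item stmt-ValiantsHypothesis-0335 · crux · rank 2 · open · by planner
why it might fail: Non-vacuous only via constant elimination for per_n (1/2, large-bit, algebraic or transcendental constants, poly cost in τ): open; per may lie in VP via such constants while τ(per_n)=n^ω(1), const-free completeness holding only up to 2^p(n); elimination known for BSS decision problems or under GRH.
sources: arXiv:2606.25121 (Bürgisser 2026) §1.2 p.3: 'VP_C ≠ VNP_C ⇒ VP⁰ ≠ VNP⁰ is trivial, but the converse is unclear'; §1.3 p.3: #P ⊄ P/poly ⇒ VP_C ≠ VNP_C known only under GRH [buerg:00], arXiv:2606.25121 §2.1 p.6: P_C = NP_C ⇔ P⁰_C = NP⁰_C by witness sequences (BSS decision problems only), arXiv:2601.00387 (Bhattacharjee–Bläser–Dutta–Mukherjee) §2.1 p.7: 'not clear whether VP⁰ ≠ VNP⁰ implies VP ≠ VNP, not even whether VP⁰ ≠ VNP⁰ ⇒ τ(per_n) = n^ω(1) ... divisions by two occur', arXiv:2601.00387 §2.1 p.7: 'some polynomial family in VNP⁰ does not lie in VP⁰, but still in VP (… exponentially large-bit integers)' — the failure mode, arXiv:1307.3863 (Mahajan 2013) p.17: 'possible that (Perm_n)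 has polynomial-sized circuits but no polynomial-sized constant-free circuits ... 1/2 is needed', Koiran2011 = arXiv:1004.4960 p.5 (τ(per_n) p-bounded? central open question; Thm 1 = Koiran2004 Thm 4.3, factor 2^p(n))
The honest gap between constant-free lower bounds (VP⁰) and VP_ℂ: eliminate arbitrary complex
constants from polynomial-size circuits for per_n at polynomial cost in the constant-free model over
ℤ. Known pieces: VP_K = VNP_K depends only on the algebraically closed field's characteristic-0
prime part, i.e. reduces to Q̄ [Burgisser2000 §4.1]; algebraic constants can be removed for Boolean
consequences under GRH [Burgisser2000 Thm 4.5; Koiran1996]; Koiran2005 on the cost of computing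
integers. Open as stated; also the hidden hypothesis of PIT-based lines
(Literature.Computability.AlgebraicComplexity.kabanets_impagliazzo). -/
@[route_item "route-ValiantsHypothesis-TauConst"]
def TauConstElim : Prop :=
  Literature.Computability.AlgebraicComplexity.VP ℂ = Literature.Computability.AlgebraicComplexity.VNP ℂ → Literature.Computability.AlgebraicComplexity.IsPBounded (fun n => Literature.Computability.AlgebraicComplexity.constantFreeComplexity (Literature.Computability.AlgebraicComplexity.perPoly (Fin n) ℤ))

/-- item stmt-ValiantsHypothesis-0336 · crux · rank 3 · open · by planner
why it might fail: False if ∏_{i≤n}(X−i) (n integer zeros) or some m_n·n! has a constant-free SLP of length (log n)^O(1) — open, best τ(n!)=O(√n log²n); the real-zero analogue IS false (Chebyshev T_{2^k}: τ≤3k, 2^k real zeros; tree TauRealZeros), so integrality must be used; only z(f)≤2^τ is known for general SLPs.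
sources: ShubSmale1995 §1 via BlumCuckerShubSmale1998 Ch.7 §7.1 'Hypothesis. Zer(f) ≤ (τ(f)+1)^c' (panama:519115517198346), Thm 3 there (⇒ P_C ≠ NP_C), Burgisser2024Completeness = arXiv:2406.06217 §4.6 p.19 (Thm 4.17; 'plausible that (n!) is hard, otherwise factoring in nonuniform P'; Lipton: hard-on-average factoring ⇒ weaker τ-conjecture), arXiv:1307.3863 (Mahajan) p.17: τ(n!) ≤ 2n−4 trivially, best known O(√n log² n) [bcs-book97]; status of (n!) 'famously open', Koiran2011 = arXiv:1004.4960 §1 p.3 (Chebyshev/Borodin–Cook obstruction to real-analytic proofs), arXiv:2601.00387 §1 p.3 and Thm (sec. tau): τ-conjecture ⇒ exponential-sum lower bounds; Pochhammer p_n definable in CH_lin, tree: Literature.Computability.AlgebraicComplexity.ShubSmaleTauConjecture (TauConjecture.lean:74) = item verbatim (Iff.rfl, grounder); barrier Literature.Barriers.ValiantsHypothesis.TauRealZeros / tauRealZeros_holds (TauRealZeros.lean:296,301)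
[ShubSmale1995; Burgisser2009 §1]: number of distinct integer zeros of f ≠ 0 is polynomial in τ(f).
τ here = constantFreeComplexity (fan-in-2, constants and sum coefficients in {0,±1}) of f
transported to MvPolynomial (Fin 1) ℤ via uniqueAlgEquiv; equals Shub–Smale's τ up to a factor ≤ 3,
absorbed by c. Diophantine input expected (heights, p-adic interpolation à la Strassmann,
Bombieri–Pila type counting). -/
@[route_item "route-ValiantsHypothesis-TauConst"]
def TauConjecture : Prop :=
  ∃ c : ℕ, ∀ f : Polynomial ℤ, f ≠ 0 → f.roots.toFinset.card ≤ (Literature.Computability.AlgebraicComplexity.constantFreeComplexity ((MvPolynomial.uniqueAlgEquiv ℤ (Fin 1)).symm f) + 2) ^ c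

/-- item stmt-ValiantsHypothesis-0358 · crux · rank 4 · open · by planner
why it might fail: Needs poly(k,m,t) distinct real zeros for Σ^kΠ^m of t-sparse f_ij; best general bound 2kt^m−1 (expand+Descartes); proved only for k=1 (≤2m(t−1)+1) and on average (Gaussian); fewnomial/Wronskian bounds stay exponential in m; one SPS family with superpolynomially many real zeros kills it.
sources: Koiran2011 = arXiv:1004.4960 §6 p.11 Conjecture 3 (real τ-conjecture; k=1 case ≤ 2m(t−1)+1; general bound 2kt^m−1; 'each of the three conjectures implies per ∉ VP⁰' via Thm 7), Koiran2011 §7 p.12 (fewnomial theory 'does not seem strong enough to imply the real τ-conjecture'), Tavenas2014 (paper:doi-10-70675-52eccebdz020az4a8dz8517z14d4aa632482) PDF p.45 Conj 3.2 + Thm 3.3 (⇒ τ(Perm_n) = n^ω(1)); p.52 Rem 3.22 (Perm ∈ VP needs GRH for the CH collapse), Tavenas2014 PDF p.53 Conj 3.23/3.24 + Lemme 3.26 (equivalent; implied by Conj 3.2); p.59 Thm 3.38: real τ-conjecture with powers ⇒ Perm ∉ VP (constants allowed, no GRH), Burgisser2024Completeness = arXiv:2406.06217 §4.6 p.20 Conj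 4.1 ('even VP ≠ VNP follows; see [tavenas-thesis]'; Hrubeš equivalents; Wronskian bounds [koir-port-tav:15]), BriquelBurgisser2020 = arXiv:1806.00417 Thm 1 (true on average; Conjecture 1 there still open)
[Koiran2011 Conj 1]: the number of distinct real roots of a nonzero Σ_{i<k} Π_{j<m} f_ij with each
f_ij t-sparse is polynomial in k, m, t. Koiran2011 Thm: real τ-conjecture ⇒ per ∉ VP⁰ (so it can
replace tau_conjecture in the assembly, still needing tau_const_elim). Real algebraic geometry
input: Descartes/Khovanskii fewnomial bounds give only exponential in m·t; Wronskian methods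
(Koiran–Portier–Tavenas) give partial cases. -/
@[route_item "route-ValiantsHypothesis-TauConst"]
def TauReal : Prop :=
  ∃ c : ℕ, ∀ (k m t : ℕ) (f : Fin k → Fin m → Polynomial ℝ), (∀ i j, (f i j).support.card ≤ t) → (∑ i, ∏ j, f i j) ≠ 0 → (∑ i, ∏ j, f i j).roots.toFinset.card ≤ (k + m + t + 2) ^ c

/-- item stmt-ValiantsHypothesis-0337 · crux (kind.auto-crux: conjecture-grade) · rank 5 · closed · proved by Summit.ValiantsHypothesis.ValiantsHypothesis.Theorems.TauConst.tauBurgisser_proof (prover) · by planner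
why it might fail: auto-crux — conjecture-grade statement (docstring avows it ('conjecture')); it is open, so it may simply be false
sources: Burgisser2009 Main Thm 1.2 = Burgisser2006 (ECCC TR06-113) Thm 1.1(2); secondary: arXiv:2406.06217 Thm 4.17 p.19, arXiv:2601.00387 §1 p.3 (proof sketch), arXiv:1004.4960 pp.3,5, tree: Literature.Computability.AlgebraicComplexity.not_isPBounded_constantFreeComplexity_perPoly_of_tauConjecture (TauConjecture.lean:142) = item verbatim; reduced to four cited facts in TauConjectureAssembly.lean:43 (…_of_facts')
Theorem in print [Burgisser2009 Thm 1.1-1.2 (STACS 2007)]: under the τ-conjecture the permanent has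
no polynomial-size constant-free arithmetic circuits (via counting integer roots of
Pochhammer–Wilkinson polynomials ∏(T-i) computed from factorial-like VNP⁰ families and Valiant
completeness in the constant-free setting). Expected to become a Literature cite fact; hypothesis of
tau_assembly. Grounder: check that constantFreeComplexity (weighted ±1 sums, fan-in 2) matches
Bürgisser's τ up to O(1). -/
@[route_item "route-ValiantsHypothesis-TauConst"]
def TauBurgisser : Prop :=
  (∃ c : ℕ, ∀ f : Polynomial ℤ, f ≠ 0 → f.roots.toFinset.card ≤ (Literature.Computability.AlgebraicComplexity.constantFreeComplexity ((MvPolynomial.uniqueAlgEquiv ℤ (Fin 1)).symm f) + 2) ^ c) → ¬ Literature.Computability.AlgebraicComplexity.IsPBounded (fun n => Literature.Computability.AlgebraicComplexity.constantFreeComplexity (Literature.Computability.AlgebraicComplexity.perPoly (Fin n) ℤ))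

-- `TauBurgisser` holds: proved by `Summit.ValiantsHypothesis.ValiantsHypothesis.Theorems.TauConst.tauBurgisser_proof` (its module imports this route file, so no `_holds` link can be stated here).

/-- item stmt-ValiantsHypothesis-10713 · support · rank 9 · closed · proved by Summit.ValiantsHypothesis.ValiantsHypothesis.Theorems.TauConst.tauRealValiant_proof (prover) · by planner
[support] Tavenas 2014 Thm 3.38 over ℂ: Koiran's real τ-conjecture (the body of item TauReal,
inlined as the hypothesis) implies that L_ℂ(PER_n) — the arithmetic-circuit complexity `complexity`
of the generic n × n permanent over ℂ, arbitrary complex constants allowed — is not p-bounded, i.e.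
PER ∉ VP_ℂ; definitionally `TauReal →
Literature.Computability.AlgebraicComplexity.PerNotPComputableComplex` (Iff.rfl), hence →
ValiantsHypothesis by
`Literature.Computability.AlgebraicComplexity.perNotPComputableComplex_iff_holds`. KNOWN RESULT:
Tavenas2014 (paper:doi-10-70675-52eccebdz020az4a8dz8517z14d4aa632482) PDF p.59 Thm 3.38 ("Si la
τ-conjecture réelle avec puissances est avérée, alors Perm ∉ VP") with Lemme 3.26 (p.53: Conj. 3.23
⇔ 3.24) and Conj. 3.2 ⇒ Conj. 3.23 (p.52); VP = VP_ℚ by the thesis' convention (p.22) and the proof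
is valid verbatim over ℝ — the P-definable Hutchinson family V_n = Σ_{i<2^n} 2^{2·2^n·i − 2i(i+1)}
X^i (Lemme 3.36; Cor. 3.37 = tree `Tavenas2014_cor_3_37`, discharged in TavenasVnWitness.lean),
depth-4 reduction WITH constants, real-zero bound; ℂ-constants reduce to ℝ-constants by splitting
every gate into real and imaginary parts (size × ≤ 6, PER_n has intege -/
@[route_item "route-ValiantsHypothesis-TauConst"]
def TauRealValiant : Prop :=
  (∃ c : ℕ, ∀ (k m t : ℕ) (f : Fin k → Fin m → Polynomial ℝ), (∀ i j, (f i j).support.card ≤ t) → (∑ i, ∏ j, f i j) ≠ 0 → (∑ i, ∏ j, f i j).roots.toFinset.card ≤ (k + m + t + 2) ^ c) → ¬ Literature.Computability.AlgebraicComplexity.IsPBounded (fun n => Literature.Computability.AlgebraicComplexity.complexity (Literature.Computability.AlgebraicComplexity.perPoly (Fin n) ℂ))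

-- `TauRealValiant` holds: proved by `Summit.ValiantsHypothesis.ValiantsHypothesis.Theorems.TauConst.tauRealValiant_proof` (its module imports this route file, so no `_holds` link can be stated here).

/-- item stmt-ValiantsHypothesis-0334 · assembly · rank 1 · closed · proved by Summit.ValiantsHypothesis.ValiantsHypothesis.Theorems.TauConst.assembly_proof (prover) · by planner
Assembly for TauConst: with Bürgisser's theorem [Burgisser2009 Thm 1.1/1.2] inlined as hypothesis,
VP ℂ = VNP ℂ would make τ(per_n) both p-bounded (const-elim) and not p-bounded. One-line logic. -/
@[route_item "route-ValiantsHypothesis-TauConst"]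
def Assembly : Prop :=
  (∃ c : ℕ, ∀ f : Polynomial ℤ, f ≠ 0 → f.roots.toFinset.card ≤ (Literature.Computability.AlgebraicComplexity.constantFreeComplexity ((MvPolynomial.uniqueAlgEquiv ℤ (Fin 1)).symm f) + 2) ^ c) ∧ (Literature.Computability.AlgebraicComplexity.VP ℂ = Literature.Computability.AlgebraicComplexity.VNP ℂ → Literature.Computability.AlgebraicComplexity.IsPBounded (fun n => Literature.Computability.AlgebraicComplexity.constantFreeComplexity (Literature.Computability.AlgebraicComplexity.perPoly (Fin n) ℤ))) → ((∃ c : ℕ, ∀ f : Polynomial ℤ, f ≠ 0 → f.roots.toFinset.card ≤ (Literature.Computability.AlgebraicComplexity.constantFreeComplexity ((MvPolynomial.uniqueAlgEquiv ℤ (Fin 1)).symm f) + 2) ^ c) → ¬ Literature.Computability.AlgebraicComplexity.IsPBounded (fun n => Literature.Computability.AlgebraicComplexity.constantFreeComplexity (Literature.Computability.AlgebraicComplexity.perPoly (Fin n) ℤ))) → ValiantsHypothesis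

-- `Assembly` holds: proved by `Summit.ValiantsHypothesis.ValiantsHypothesis.Theorems.TauConst.assembly_proof` (its module imports this route file, so no `_holds` link can be stated here).

/-! D-0027 §2.1 — DECIDING THEOREM (planner-authored via `route open/edit --closes-file`; by planner-rbadge-ValiantsHypothesis-TauConst-9c537c58-g2-0 2026-08-15T16:59:55Z):
its hypotheses are this route's items and its conclusion the sub-problem Statement (glue_lint), and it elaborates with this file. -/

@[closes "route-ValiantsHypothesis-TauConst"] theorem closes (h_TauConjecture : TauConjecture) (h_TauConstElim : TauConstElim)
    (h_TauBurgisser : TauBurgisser) : _root_.ValiantsHypothesis :=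
  fun hEq => h_TauBurgisser h_TauConjecture (h_TauConstElim hEq)

end Summit.ValiantsHypothesis.ValiantsHypothesis.Theses.TauConst
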